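import Summits.BirchSwinnertonDyer.Rank1Residual.X1.TamagawaSqueeze
import Summits.BirchSwinnertonDyer.Rank1Residual.X1.ResidualDescent
import HarnessLib

/-!
# Route N — the FACTORISATION squeeze on the leaf X1 ∩ {r = 0}:
# `λ_alg` is the `λ` of a `Λ`-DIVISOR of `ϖ·L_p(E,T)`; if no admissible divisor degree lies in
# `[k, λ_an − 2]`, the μ-part and `λ_alg ≥ k` give Mazur's main conjecture, hence `BSD(E,p)`

HONEST FRAMING (cell `b2b-bsdres`, run/shared/lean/b2b/bsd-rank1-residual/, verbatim in every
file): the goal of the cell is to DELETE the COMBINATION-SHAPED residual classes of the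
Birch–Swinnerton-Dyer formula for ALL analytic-rank `≤ 1` elliptic curves over `ℚ` — "full BSD
formula for every rank `≤ 1` curve in class `C`" assembled STRICTLY from published theorems — so
that the rank-`≤ 1` remainder becomes exactly the CONSTRUCTION-SHAPED classes, which are TYPED
(missing-input `Prop`s), NOT attempted. This is not "finishing BSD". Sub-cell
`b2b-bsdres-eisenstein-p1` (CLASS-OWNERS row "X1 (r=0)"), gen 10: research route; NO CLAIM BEYOND
STATED CLASSES; nothing here changes a label. ONE typed def (`AnalyticLamDivisorSet`, "the `λ` of
every `Λ`-divisor of `ϖ·L_p(E,T)` lies in `A`", nothing asserted); everything else is a theorem over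
PUBLISHED named facts and the cell's typed per-pair inputs (`MuPartAt`, `AnalyticMuLE`,
`AnalyticLambdaEq`, `AlgebraicLambdaGE`).

WHY THIS FILE. Routes P/T/D close Mazur's main conjecture at a leaf pair from Kato–Wuthrich's
`ϖ·L_p = ι(f_E·h)`, the μ-part, parity and a LOWER bound `λ(f_E) ≥ λ_an − 1`; route D's descent
bounds stop at `pⁿ` per level, and the census residue has one long Jordan block (cyclic-like), out of
reach of level `3`. Route N uses ARITHMETIC OF `Λ` ON THE ANALYTIC SIDE instead: `f_E·h = g_an` in
`Λ = ℤ_p⟦T⟧`, so by Weierstrass preparation (uniqueness) the distinguished polynomial of `f_E`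
divides `P_an`, the distinguished polynomial of `g_an`, and by unique factorisation in `ℚ_p[T]`
`λ(f_E)` is a SUBSET SUM of the multiset of `ℚ_p`-irreducible factor degrees of `P_an`
([Washington1997] Thm. 7.3, Prop. 7.6). That multiset is a finite `p`-adic computation on the first
`λ_an + 1` coefficients of `ϖ·L_p(E,T)`: principal Newton polygon + Ore's residual polynomials
(a segment of slope `h/e` whose residual polynomial has a SIMPLE irreducible factor `ψ` yields an
irreducible factor of degree `e·deg ψ`; [Cohen1993] Prop. 6.2.3 after Ore 1928), certified per pair
by two engines (eisenstein-p1 gen 10 `routeN`), exactly as `λ_an = n` is. The kernel TYPES the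
outcome (`AnalyticLamDivisorSet W p A`: every `Λ`-divisor `g` of `ϖ·L_p` has `λ(g) ∈ A`) and
asserts nothing. THE SQUEEZE (PROVED): `λ(f_E) ∈ A`, `λ(f_E·h) = n`, `λ(f_E) = λ(X) ≥ k`, `λ(f_E)` and
`n` even (Prop. 3.10 at corank `0`; the leaf); if `∀ d ∈ A, Even d → k ≤ d → n ≤ d + 1` then
`n ≤ λ(f_E)` = the λ-part; with `MuPartAt`, Wuthrich's Thm. 16 gives the main conjecture and on the
leaf `BSD(E,p)`. `A = {0, n}` (`P_an` irreducible, e.g. EISENSTEIN) needs only `λ_alg ≥ 1`: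
Greenberg's `26b@7` (LNM 1716 p. 183) and the route-D residue class `12470b@3` (`λ_an = 12`) are
of this kind. Route P is `n = 2`; route T is `A = univ`.

* `AnalyticLamDivisorSet W p A` (TYPED), `.mono`, `analyticLamDivisorSet_univ`.
* `lambdaPartAt_of_lamDivisorSet` (no parity), `…_of_even` (parity), `…_of_residualDescent_of_even`
  (lower bound = route D's `ResidualDescentBound W p k e`), `mazurMainConjecture_of_lamDivisorSet(_of_even)`.
* `Leaf.mazurMainConjecture_of_lamDivisorSet`, `Leaf.bsdp_of_lamDivisorSet`,
  `Leaf.bsdp_of_muZero_of_lamDivisorSet` (headline), `…_of_residualDescent`,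
  `Leaf.bsdp_of_muZero_of_irreducible`, `Leaf.exists_mem_of_lamDivisorSet` (consistency).

References: [Washington1997] Thm. 7.3, Lemma 7.5–Prop. 7.6 (Weierstrass preparation, `Λ` is a UFD
whose primes are `p` and the irreducible distinguished polynomials); [GreenbergLNM1716] Prop. 3.10,
Thm. 4.1, §5 pp. 131 ("`f_E(0) ∼ 7` … implies that `f_E(T)` is an irreducible element of `Λ`"),
183; [Wuthrich2014] Thm. 16; HOME/b2b-bsdres-eisenstein-p1/X1R0-GAPMAP.md §19.
-/

noncomputable section

open scoped Classical MatrixGroups ModularForm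

open PowerSeries CongruenceSubgroup WeierstrassCurve Literature.NumberTheory.EllipticCurves
  Literature.NumberTheory.EllipticCurves.ModularForms
  Literature.NumberTheory.EllipticCurves.Rank1Residual
  Literature.NumberTheory.EllipticCurves.Greenberg1999
  Summit.BirchSwinnertonDyer.BirchSwinnertonDyer.Theorems.Rank1ResidualX1Defs
  Summit.BirchSwinnertonDyer.Rank1Residual.X1.MuLambda
  Summit.BirchSwinnertonDyer.Rank1Residual.X1.MuPart
  Summit.BirchSwinnertonDyer.Rank1Residual.X1.ParitySqueeze
  Summit.BirchSwinnertonDyer.Rank1Residual.X1.TamagawaSqueeze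

set_option autoImplicit false

namespace Summit.BirchSwinnertonDyer.Rank1Residual.X1.FactorSqueeze

/-! ## §1. "every `Λ`-divisor of `ϖ·L_p(E,T)` has `λ` in `A`", TYPED (nothing asserted) -/

/-- **"`λ(g) ∈ A` for every `Λ`-divisor `g` of `ϖ·L_p(E,T)`" (TYPED; nothing asserted).** For the
newform `f` of `E`, every rational `ϖ` with `ϖ·Ω_E = Ω⁺_f` (Néron normalisation of `X1/MuLambda.lean`)
and all `g, h ∈ Λ = ℤ_p⟦T⟧` with `ι(g·h) = ϖ·L_p(f,α)`: `λ(g) ∈ A`. CERTIFICATE (outside the kernel):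
by Weierstrass preparation and unique factorisation in `ℚ_p[T]` the distinguished polynomial of `g`
divides that of `g·h`, so `λ(g)` is a subset sum of the degrees (with multiplicity) of the
`ℚ_p`-irreducible factors of the distinguished polynomial `P_an` of `ϖ·L_p` (when `μ_an = 0`); any
`A` containing those subset sums qualifies — computed per pair from the Newton polygon of `ϖ·L_p` and
Ore's residual polynomials by two engines (eisenstein-p1 `routeN`). `A = univ` always qualifies
(and `A = Iic n` when `λ_an = n`, by `MuLambda.lam_le_lam_mul`).
[cite: Washington1997, Thm. 7.3 and Prop. 7.6 (shape only; nothing asserted)] -/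
def AnalyticLamDivisorSet (W : WeierstrassCurve ℚ) [W.IsElliptic] [W.IsGloballyMinimal] (p : ℕ)
    [Fact p.Prime] (A : Set ℕ) : Prop :=
  ∀ [NeZero (W.conductorNorm ℤ)] (f : CuspForm (Gamma0 (W.conductorNorm ℤ)) 2),
    IsNewformOf W f → ∀ (ϖ : ℚ), (ϖ : ℝ) * W.realPeriodRat = plusPeriod f →
    ∀ (g h : IwasawaAlgebra p),
      iwasawaToPowerSeries p (g * h) = C (ϖ : ℚ_[p]) * padicLFunction f (unitRoot W p : ℚ_[p]) →
      lam g ∈ A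

section Basic

variable {W : WeierstrassCurve ℚ} [W.IsElliptic] [W.IsGloballyMinimal] {p : ℕ} [Fact p.Prime]

/-- `AnalyticLamDivisorSet` is monotone in the set. [folklore] -/
theorem AnalyticLamDivisorSet.mono {A B : Set ℕ} (hAB : A ⊆ B) (hA : AnalyticLamDivisorSet W p A) :
    AnalyticLamDivisorSet W p B :=
  fun f hf ϖ hϖ g h hι ↦ hAB (hA f hf ϖ hϖ g h hι)

omit [W.IsElliptic] [W.IsGloballyMinimal] in
/-- The trivial certificate `A = univ`. [folklore] -/
theorem analyticLamDivisorSet_univ (W : WeierstrassCurve ℚ) [W.IsElliptic] [W.IsGloballyMinimal]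
    (p : ℕ) [Fact p.Prime] : AnalyticLamDivisorSet W p Set.univ :=
  fun _ _ _ _ _ _ _ ↦ Set.mem_univ _

end Basic

/-! ## §2. Route N: the λ-part and Mazur's main conjecture from a divisor-degree gap -/

section Squeeze

variable {W : WeierstrassCurve ℚ} [W.IsElliptic] [W.IsGloballyMinimal] {p : ℕ} [Fact p.Prime]

/-- **Route N, λ-part (no parity).** `W/ℚ` globally minimal elliptic, `p ≠ 2` good ordinary with
`E[p]` reducible; granted Wuthrich 2014 Thm. 16 (`hW16`, PUBLISHED): if `λ_an(E,p) = n`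
(`AnalyticLambdaEq W p n`), every `Λ`-divisor of `ϖ·L_p` has `λ ∈ A` (`AnalyticLamDivisorSet W p A`),
`λ_alg(E,p) ≥ k` (`AlgebraicLambdaGE W p k`), and the finite GAP CHECK `∀ d ∈ A, k ≤ d → n ≤ d`
passes, then the λ-part `LambdaPartAt W p` holds: `λ(f_E) ∈ A` and `k ≤ λ(X) = λ(f_E)` (structure
theorem, `ParitySqueeze.lam_generator_eq_lambdaInvariant`) give `n ≤ λ(f_E)`, i.e.
`λ(f_E·h) ≤ λ(f_E)`. [cite: Wuthrich2014, Thm. 16 (p. 397)] [cite: Washington1997, Thm. 7.3 and Prop. 7.6] -/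
theorem lambdaPartAt_of_lamDivisorSet (hW16 : Wuthrich2014.charIdeal_dvd_padicLFunction)
    (hp : p ≠ 2) (hgood : W.HasGoodReductionAtPrime p) (hord : ¬ (p : ℤ) ∣ W.frobeniusTrace p)
    (hred : ¬ W.HasIrreducibleModPGaloisRep p) {n k : ℕ} {A : Set ℕ} (hlam : AnalyticLambdaEq W p n)
    (hA : AnalyticLamDivisorSet W p A) (hk : AlgebraicLambdaGE W p k)
    (hgap : ∀ d ∈ A, k ≤ d → n ≤ d) : LambdaPartAt W p := by
  intro κ γ hκ hγ hγ' _ f hf ϖ hϖ D g h hchar hι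
  haveI : Module.Finite (IwasawaAlgebra p) D.X := D.module_finite_holds hγ
  obtain ⟨hX, -⟩ := hW16 W p hp ⟨hgood, hord⟩ hred hκ hγ hγ' hf D ϖ hϖ
  have hgh : g * h ≠ 0 := mul_ne_zero_of_iota_eq hgood hord hf hϖ D hι
  have hg : g ≠ 0 := fun h0 ↦ hgh (by rw [h0, zero_mul])
  have h1 : lam (g * h) = n := hlam f hf ϖ hϖ (g * h) hι
  have h2 : lam g = lambdaInvariant p D.X := lam_generator_eq_lambdaInvariant D.X hX hg hchar
  have h3 : k ≤ lambdaInvariant p D.X := hk κ γ hκ hγ D hX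
  have h4 : lam g ∈ A := hA f hf ϖ hϖ g h hι
  have h5 : n ≤ lam g := hgap (lam g) h4 (by omega)
  omega

/-- **Route N, λ-part with parity.** As `lambdaPartAt_of_lamDivisorSet`, with the weaker gap check
`∀ d ∈ A, Even d → k ≤ d → n ≤ d + 1`, for `n` EVEN and `Sel_{p^∞}(E/ℚ)` finite (so `corank = 0` and
`λ(f_E)` is even by Greenberg's Prop. 3.10, `h310`, PUBLISHED): the check applies to `d = λ(f_E)` and
`n ≤ λ(f_E) + 1` with both even forces `n ≤ λ(f_E)`.
[cite: GreenbergLNM1716, Prop. 3.10 and §5 p. 183] [cite: Wuthrich2014, Thm. 16 (p. 397)] -/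
theorem lambdaPartAt_of_lamDivisorSet_of_even
    (hW16 : Wuthrich2014.charIdeal_dvd_padicLFunction)
    (h310 : prop310_selmerCorank_mod_two_eq_lambdaInvariant)
    (hp : p ≠ 2) (hgood : W.HasGoodReductionAtPrime p) (hord : ¬ (p : ℤ) ∣ W.frobeniusTrace p)
    (hred : ¬ W.HasIrreducibleModPGaloisRep p) (hSel : Finite (W.selmerGroupPInfty p))
    {n k : ℕ} {A : Set ℕ} (hn : Even n) (hlam : AnalyticLambdaEq W p n)
    (hA : AnalyticLamDivisorSet W p A) (hk : AlgebraicLambdaGE W p k)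
    (hgap : ∀ d ∈ A, Even d → k ≤ d → n ≤ d + 1) : LambdaPartAt W p := by
  intro κ γ hκ hγ hγ' _ f hf ϖ hϖ D g h hchar hι
  haveI : Module.Finite (IwasawaAlgebra p) D.X := D.module_finite_holds hγ
  obtain ⟨hX, -⟩ := hW16 W p hp ⟨hgood, hord⟩ hred hκ hγ hγ' hf D ϖ hϖ
  have hgh : g * h ≠ 0 := mul_ne_zero_of_iota_eq hgood hord hf hϖ D hι
  have hg : g ≠ 0 := fun h0 ↦ hgh (by rw [h0, zero_mul])
  have h1 : lam (g * h) = n := hlam f hf ϖ hϖ (g * h) hι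
  have h2 : lam g = lambdaInvariant p D.X := lam_generator_eq_lambdaInvariant D.X hX hg hchar
  have h3 : k ≤ lambdaInvariant p D.X := hk κ γ hκ hγ D hX
  have hcork : W.selmerCorank p = 0 := by
    haveI := hSel
    exact zpCorank_eq_zero_of_finite (W.selmerGroupPInfty p) p
  have heven : Even (lam g) := by
    rw [h2]
    exact prop310_selmerCorank_mod_two_eq_lambdaInvariant.even_lambdaInvariant_of_selmerCorank_eq_zero
      h310 W p hp hκ hγ D hX hcork
  have h4 : lam g ∈ A := hA f hf ϖ hϖ g h hι
  have h5 : n ≤ lam g + 1 := hgap (lam g) h4 heven (by omega)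
  obtain ⟨a, ha⟩ := heven
  obtain ⟨b, hb⟩ := hn
  omega

/-- **Route N: Mazur's main conjecture** from the μ-part (`MuPartAt W p`), `λ_an = n`, the divisor set
`A`, `λ_alg ≥ k` and the gap check `∀ d ∈ A, k ≤ d → n ≤ d` (Wuthrich Thm. 16:
`MC ⟺ μ-part ∧ λ-part`, `X1/MuLambda.lean`). [cite: Wuthrich2014, Thm. 16 (p. 397)]
[cite: Washington1997, Thm. 7.3 and Prop. 7.6] -/
theorem mazurMainConjecture_of_lamDivisorSet (hW16 : Wuthrich2014.charIdeal_dvd_padicLFunction)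
    (hp : p ≠ 2) (hgood : W.HasGoodReductionAtPrime p) (hord : ¬ (p : ℤ) ∣ W.frobeniusTrace p)
    (hred : ¬ W.HasIrreducibleModPGaloisRep p) (hμ : MuPartAt W p) {n k : ℕ} {A : Set ℕ}
    (hlam : AnalyticLambdaEq W p n) (hA : AnalyticLamDivisorSet W p A) (hk : AlgebraicLambdaGE W p k)
    (hgap : ∀ d ∈ A, k ≤ d → n ≤ d) : MazurMainConjecture W p :=
  (mazurMainConjecture_iff_muPart_and_lambdaPart hW16 hp hgood hord hred).mpr
    ⟨hμ, lambdaPartAt_of_lamDivisorSet hW16 hp hgood hord hred hlam hA hk hgap⟩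

/-- **Route N with parity: Mazur's main conjecture** from the μ-part, `λ_an = n` even, the divisor set
`A`, `λ_alg ≥ k`, `Sel_{p^∞}(E/ℚ)` finite, Greenberg's Prop. 3.10 (`h310`) and the gap check
`∀ d ∈ A, Even d → k ≤ d → n ≤ d + 1`. [cite: GreenbergLNM1716, Prop. 3.10]
[cite: Wuthrich2014, Thm. 16 (p. 397)] [cite: Washington1997, Thm. 7.3 and Prop. 7.6] -/
theorem mazurMainConjecture_of_lamDivisorSet_of_even
    (hW16 : Wuthrich2014.charIdeal_dvd_padicLFunction)
    (h310 : prop310_selmerCorank_mod_two_eq_lambdaInvariant)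
    (hp : p ≠ 2) (hgood : W.HasGoodReductionAtPrime p) (hord : ¬ (p : ℤ) ∣ W.frobeniusTrace p)
    (hred : ¬ W.HasIrreducibleModPGaloisRep p) (hSel : Finite (W.selmerGroupPInfty p))
    (hμ : MuPartAt W p) {n k : ℕ} {A : Set ℕ} (hn : Even n) (hlam : AnalyticLambdaEq W p n)
    (hA : AnalyticLamDivisorSet W p A) (hk : AlgebraicLambdaGE W p k)
    (hgap : ∀ d ∈ A, Even d → k ≤ d → n ≤ d + 1) : MazurMainConjecture W p :=
  (mazurMainConjecture_iff_muPart_and_lambdaPart hW16 hp hgood hord hred).mpr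
    ⟨hμ, lambdaPartAt_of_lamDivisorSet_of_even hW16 h310 hp hgood hord hred hSel hn hlam hA hk hgap⟩

/-- **Route N fed by route D (residual descent) at the `μ = 0` member.** As
`lambdaPartAt_of_lamDivisorSet_of_even`, but the lower bound is route D's typed input
`ResidualDescentBound W p k e` (`k` descent witnesses at some level of the cyclotomic tower, `e` of
them trivially explained: `λ(X) ≥ k − e` once `μ(X) = 0`, which follows from `μ_an = 0`,
`MuPart.mu_eq_zero_of_analyticMuLE_zero`; `X1/ResidualDescent.lean`), so the gap check reads
`∀ d ∈ A, Even d → k ≤ d + e → n ≤ d + 1`. This is the form in which the census's level-2 descent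
bounds (S₃-descent, eisenstein-p1 gen 9) combine with the factorisation pattern.
[cite: GreenbergVatsal2000, §2 Prop. (2.8), Cor. (2.3), Prop. (2.4)] [cite: GreenbergLNM1716, Prop. 3.10]
[cite: Wuthrich2014, Thm. 16 (p. 397)] [cite: Washington1997, Thm. 7.3 and Prop. 7.6] -/
theorem lambdaPartAt_of_lamDivisorSet_of_residualDescent_of_even
    (hW16 : Wuthrich2014.charIdeal_dvd_padicLFunction) (hmod : nonempty_modularParametrizationData)
    (h310 : prop310_selmerCorank_mod_two_eq_lambdaInvariant)
    (hp : p ≠ 2) (hgood : W.HasGoodReductionAtPrime p) (hord : ¬ (p : ℤ) ∣ W.frobeniusTrace p)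
    (hred : ¬ W.HasIrreducibleModPGaloisRep p) (hSel : Finite (W.selmerGroupPInfty p))
    (hμ0 : AnalyticMuLE W p 0) {n k e : ℕ} {A : Set ℕ} (hn : Even n) (hlam : AnalyticLambdaEq W p n)
    (hA : AnalyticLamDivisorSet W p A) (hD : ResidualDescent.ResidualDescentBound W p k e)
    (hgap : ∀ d ∈ A, Even d → k ≤ d + e → n ≤ d + 1) : LambdaPartAt W p := by
  intro κ γ hκ hγ hγ' _ f hf ϖ hϖ D g h hchar hι
  haveI : Module.Finite (IwasawaAlgebra p) D.X := D.module_finite_holds hγ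
  obtain ⟨hX, h3⟩ := ResidualDescent.isTorsion_and_le_lambdaInvariant_of_residualDescentBound hW16 hmod
    hp hgood hord hred hμ0 hD hκ hγ hγ' D
  have hgh : g * h ≠ 0 := mul_ne_zero_of_iota_eq hgood hord hf hϖ D hι
  have hg : g ≠ 0 := fun h0 ↦ hgh (by rw [h0, zero_mul])
  have h1 : lam (g * h) = n := hlam f hf ϖ hϖ (g * h) hι
  have h2 : lam g = lambdaInvariant p D.X := lam_generator_eq_lambdaInvariant D.X hX hg hchar
  have hcork : W.selmerCorank p = 0 := by
    haveI := hSel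
    exact zpCorank_eq_zero_of_finite (W.selmerGroupPInfty p) p
  have heven : Even (lam g) := by
    rw [h2]
    exact prop310_selmerCorank_mod_two_eq_lambdaInvariant.even_lambdaInvariant_of_selmerCorank_eq_zero
      h310 W p hp hκ hγ D hX hcork
  have h4 : lam g ∈ A := hA f hf ϖ hϖ g h hι
  have h5 : n ≤ lam g + 1 := hgap (lam g) h4 heven (by omega)
  obtain ⟨a, ha⟩ := heven
  obtain ⟨b, hb⟩ := hn
  omega

end Squeeze

/-! ## §3. On the leaf X1 ∩ {r = 0}: route N closes `BSD(E,p)` -/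

section Leaf

variable {W : WeierstrassCurve ℚ} [W.IsElliptic] [W.IsGloballyMinimal] {p : ℕ} [Fact p.Prime]

/-- **Route N on the leaf: Mazur's main conjecture** from `MuPartAt W p`, `λ_an = n`, the divisor
set `A`, `λ_alg ≥ k` and the parity gap check — parity is automatic on the leaf (`λ_an` even:
`ParitySqueeze.Leaf.even_of_analyticLambdaEq`; `λ(f_E)` even: Prop. 3.10 at corank `0`, the Selmer
group being finite by Gross–Zagier–Kolyvagin/Kato, `TamagawaSqueeze.Leaf.finite_selmerGroupPInfty`).
Facts `hW16`, `h310`, `hmod`, `hGZK` all PUBLISHED. [cite: GreenbergLNM1716, Prop. 3.10]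
[cite: Wuthrich2014, Thm. 16 (p. 397)] [cite: Washington1997, Thm. 7.3 and Prop. 7.6] -/
theorem Leaf.mazurMainConjecture_of_lamDivisorSet
    (hW16 : Wuthrich2014.charIdeal_dvd_padicLFunction)
    (h310 : prop310_selmerCorank_mod_two_eq_lambdaInvariant)
    (hmod : nonempty_modularParametrizationData)
    (hGZK : rank_eq_analyticRank_of_analyticRank_le_one) (hL : RankZero.Leaf W p)
    (hμ : MuPartAt W p) {n k : ℕ} {A : Set ℕ} (hlam : AnalyticLambdaEq W p n)
    (hA : AnalyticLamDivisorSet W p A) (hk : AlgebraicLambdaGE W p k)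
    (hgap : ∀ d ∈ A, Even d → k ≤ d → n ≤ d + 1) : MazurMainConjecture W p :=
  have hX := isClassX1_of_classX1 hL.classX1
  mazurMainConjecture_of_lamDivisorSet_of_even hW16 h310 hX.two_ne hX.hasGoodReductionAtPrime
    hX.not_dvd_frobeniusTrace hX.not_hasIrreducibleModPGaloisRep
    (TamagawaSqueeze.Leaf.finite_selmerGroupPInfty hmod hGZK hL) hμ
    (ParitySqueeze.Leaf.even_of_analyticLambdaEq hW16 hmod hL hlam) hlam hA hk hgap

/-- **Route N on the leaf: `BSD(E,p)`** (general form), through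
`RankZero.Leaf.mazurMainConjecture_iff_bsdp` (Greenberg 4.1 `hGr`, modularity, Gross–Zagier–Kolyvagin;
all PUBLISHED). [cite: GreenbergLNM1716, Prop. 3.10, Thm. 4.1] [cite: Wuthrich2014, Thm. 16 (p. 397)]
[cite: Washington1997, Thm. 7.3 and Prop. 7.6] -/
theorem Leaf.bsdp_of_lamDivisorSet
    (hW16 : Wuthrich2014.charIdeal_dvd_padicLFunction) (hGr : greenberg_charValue_rankZero)
    (h310 : prop310_selmerCorank_mod_two_eq_lambdaInvariant)
    (hmod : nonempty_modularParametrizationData)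
    (hGZK : rank_eq_analyticRank_of_analyticRank_le_one) (hL : RankZero.Leaf W p)
    (hμ : MuPartAt W p) {n k : ℕ} {A : Set ℕ} (hlam : AnalyticLambdaEq W p n)
    (hA : AnalyticLamDivisorSet W p A) (hk : AlgebraicLambdaGE W p k)
    (hgap : ∀ d ∈ A, Even d → k ≤ d → n ≤ d + 1) : BSDp W p :=
  (RankZero.Leaf.mazurMainConjecture_iff_bsdp hW16 hGr hmod hGZK hL).mp
    (Leaf.mazurMainConjecture_of_lamDivisorSet hW16 h310 hmod hGZK hL hμ hlam hA hk hgap)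

/-- **Route N, headline form at the `μ = 0` member: `μ_an = 0 ∧ λ_an = n ∧ (divisor set A) ∧
λ_alg ≥ k ∧ gap ⇒ BSD(E,p)`** on the leaf (μ-part automatic at `μ_an = 0`,
`MuPart.muPartAt_of_analyticMuLE_zero`). Examples from the census (eisenstein-p1 gen 10, engine
`routeN`): `26b@7` (`λ_an = 4`), `4045a@3` (`λ_an = 8`), `7882a@3` (`λ_an = 10`) and `12470b@3`
(`λ_an = 12`, family `B = 145` of the route-D residue) all have `P_an` EISENSTEIN, so `A = {0, λ_an}`
and `k = 1` (route T) closes them; `11830i@3` (`λ_an = 6`, two irreducible cubic factors: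
`A = {0, 3, 6}`) closes by parity. [cite: GreenbergLNM1716, Prop. 3.10, Thm. 4.1, §5 p. 183]
[cite: Wuthrich2014, Thm. 16 (p. 397)] [cite: Washington1997, Thm. 7.3 and Prop. 7.6] -/
theorem Leaf.bsdp_of_muZero_of_lamDivisorSet
    (hW16 : Wuthrich2014.charIdeal_dvd_padicLFunction) (hGr : greenberg_charValue_rankZero)
    (h310 : prop310_selmerCorank_mod_two_eq_lambdaInvariant)
    (hmod : nonempty_modularParametrizationData)
    (hGZK : rank_eq_analyticRank_of_analyticRank_le_one) (hL : RankZero.Leaf W p)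
    (hμ0 : AnalyticMuLE W p 0) {n k : ℕ} {A : Set ℕ} (hlam : AnalyticLambdaEq W p n)
    (hA : AnalyticLamDivisorSet W p A) (hk : AlgebraicLambdaGE W p k)
    (hgap : ∀ d ∈ A, Even d → k ≤ d → n ≤ d + 1) : BSDp W p :=
  have hX := isClassX1_of_classX1 hL.classX1
  Leaf.bsdp_of_lamDivisorSet hW16 hGr h310 hmod hGZK hL
    (muPartAt_of_analyticMuLE_zero hW16 hX.two_ne hX.hasGoodReductionAtPrime
      hX.not_dvd_frobeniusTrace hX.not_hasIrreducibleModPGaloisRep hμ0) hlam hA hk hgap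

/-- **Route N fed by route D on the leaf: `μ_an = 0 ∧ λ_an = n ∧ (divisor set A) ∧
ResidualDescentBound k e ∧ gap ⇒ BSD(E,p)`** — the lower bound is the residual-descent witness
count of `X1/ResidualDescent.lean` (`λ_alg ≥ k − e`), the form delivered by the census at level `2`
of the cyclotomic tower. [cite: GreenbergVatsal2000, §2 Prop. (2.8), Cor. (2.3), Prop. (2.4)]
[cite: GreenbergLNM1716, Prop. 3.10, Thm. 4.1] [cite: Wuthrich2014, Thm. 16 (p. 397)]
[cite: Washington1997, Thm. 7.3 and Prop. 7.6] -/
theorem Leaf.bsdp_of_muZero_of_lamDivisorSet_of_residualDescent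
    (hW16 : Wuthrich2014.charIdeal_dvd_padicLFunction) (hGr : greenberg_charValue_rankZero)
    (h310 : prop310_selmerCorank_mod_two_eq_lambdaInvariant)
    (hmod : nonempty_modularParametrizationData)
    (hGZK : rank_eq_analyticRank_of_analyticRank_le_one) (hL : RankZero.Leaf W p)
    (hμ0 : AnalyticMuLE W p 0) {n k e : ℕ} {A : Set ℕ} (hlam : AnalyticLambdaEq W p n)
    (hA : AnalyticLamDivisorSet W p A) (hD : ResidualDescent.ResidualDescentBound W p k e)
    (hgap : ∀ d ∈ A, Even d → k ≤ d + e → n ≤ d + 1) : BSDp W p :=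
  have hX := isClassX1_of_classX1 hL.classX1
  (RankZero.Leaf.mazurMainConjecture_iff_bsdp hW16 hGr hmod hGZK hL).mp <|
    (mazurMainConjecture_iff_muPart_and_lambdaPart hW16 hX.two_ne hX.hasGoodReductionAtPrime
        hX.not_dvd_frobeniusTrace hX.not_hasIrreducibleModPGaloisRep).mpr
      ⟨muPartAt_of_analyticMuLE_zero hW16 hX.two_ne hX.hasGoodReductionAtPrime
          hX.not_dvd_frobeniusTrace hX.not_hasIrreducibleModPGaloisRep hμ0,
        lambdaPartAt_of_lamDivisorSet_of_residualDescent_of_even hW16 hmod h310 hX.two_ne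
          hX.hasGoodReductionAtPrime hX.not_dvd_frobeniusTrace hX.not_hasIrreducibleModPGaloisRep
          (TamagawaSqueeze.Leaf.finite_selmerGroupPInfty hmod hGZK hL) hμ0
          (ParitySqueeze.Leaf.even_of_analyticLambdaEq hW16 hmod hL hlam) hlam hA hD hgap⟩

/-- **The irreducible case: `μ_an = 0`, `λ_an = n`, every `Λ`-divisor of `ϖ·L_p` has `λ ∈ {0, n}`
(e.g. `P_an` irreducible over `ℚ_p` — Eisenstein when `ord_p` of the constant term is `1`) and
`λ_alg ≥ 1` ⇒ `BSD(E,p)`** on the leaf. Greenberg's conductor-`26` example at `p = 7` (LNM 1716,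
p. 183) is of this kind. [cite: GreenbergLNM1716, §5 pp. 131, 183] [cite: Wuthrich2014, Thm. 16 (p. 397)]
[cite: Washington1997, Thm. 7.3 and Prop. 7.6] -/
theorem Leaf.bsdp_of_muZero_of_irreducible
    (hW16 : Wuthrich2014.charIdeal_dvd_padicLFunction) (hGr : greenberg_charValue_rankZero)
    (h310 : prop310_selmerCorank_mod_two_eq_lambdaInvariant)
    (hmod : nonempty_modularParametrizationData)
    (hGZK : rank_eq_analyticRank_of_analyticRank_le_one) (hL : RankZero.Leaf W p)
    (hμ0 : AnalyticMuLE W p 0) {n : ℕ} (hlam : AnalyticLambdaEq W p n)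
    (hA : AnalyticLamDivisorSet W p {0, n}) (hk : AlgebraicLambdaGE W p 1) : BSDp W p := by
  refine Leaf.bsdp_of_muZero_of_lamDivisorSet hW16 hGr h310 hmod hGZK hL hμ0 hlam hA hk ?_
  intro d hd _ h1
  rcases hd with rfl | rfl
  · exact absurd h1 (by omega)
  · omega

/-- **Consistency: a certified divisor set always contains `λ_alg`** — on the leaf there is SOME
`d ∈ A` with `k ≤ d ≤ n` whenever `AlgebraicLambdaGE W p k`, `AnalyticLambdaEq W p n` and
`AnalyticLamDivisorSet W p A` hold (namely `d = λ(f_E)`: the data exist — modularity, the cyclotomic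
`κ, γ`, a dual datum — and `ϖ·L_p = ι(f_E·h)`). The kernel form of the census's falsification test
(an `A` avoiding `[k, n]` would contradict Kato–Wuthrich). [cite: Wuthrich2014, Thm. 16 (p. 397)] -/
theorem Leaf.exists_mem_of_lamDivisorSet
    (hW16 : Wuthrich2014.charIdeal_dvd_padicLFunction) (hmod : nonempty_modularParametrizationData)
    (hL : RankZero.Leaf W p) {n k : ℕ} {A : Set ℕ} (hk : AlgebraicLambdaGE W p k)
    (hn : AnalyticLambdaEq W p n) (hA : AnalyticLamDivisorSet W p A) :
    ∃ d ∈ A, k ≤ d ∧ d ≤ n := by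
  have hX := isClassX1_of_classX1 hL.classX1
  haveI : NeZero (W.conductorNorm ℤ) := ⟨(W.conductorNorm_pos_holds).ne'⟩
  obtain ⟨Dm⟩ := hmod W
  have hf : IsNewformOf W Dm.f := Dm.isNewformOf
  obtain ⟨ϖ, -, hϖeq, -⟩ := Dm.exists_rat_mul_realPeriodRat_eq_plusPeriod
  obtain ⟨κ, hκ, γ, hγ, hγ'⟩ := exists_isCyclotomic_isTopGenerator_isCyclotomicVariable_holds p
  obtain ⟨D⟩ := W.nonempty_selmerDualData_holds κ γ hγ
  haveI : Module.Finite (IwasawaAlgebra p) D.X := D.module_finite_holds hγ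
  obtain ⟨hXt, g, hgmem, hιg⟩ := hW16 W p hX.two_ne
    ⟨hX.hasGoodReductionAtPrime, hX.not_dvd_frobeniusTrace⟩ hX.not_hasIrreducibleModPGaloisRep
    hκ hγ hγ' hf D ϖ hϖeq
  obtain ⟨fE, hchar⟩ := (charIdeal_isPrincipal_holds p D.X).principal
  have hchar' : D.charIdeal = Ideal.span {fE} := hchar
  have hgmem' : g ∈ Ideal.span {fE} := by rw [← hchar']; exact hgmem
  obtain ⟨h, hgh⟩ := Ideal.mem_span_singleton'.mp hgmem'
  have hfac : fE * h = g := by rw [mul_comm]; exact hgh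
  have hι' : iwasawaToPowerSeries p (fE * h) =
      C (ϖ : ℚ_[p]) * padicLFunction Dm.f (unitRoot W p : ℚ_[p]) := by rw [hfac, hιg]
  have hg0 : fE * h ≠ 0 :=
    mul_ne_zero_of_iota_eq hX.hasGoodReductionAtPrime hX.not_dvd_frobeniusTrace hf hϖeq D hι'
  have hfE0 : fE ≠ 0 := fun h0 ↦ hg0 (by rw [h0, zero_mul])
  have hh0 : h ≠ 0 := fun h0 ↦ hg0 (by rw [h0, mul_zero])
  have h1 : lam (fE * h) = n := hn Dm.f hf ϖ hϖeq (fE * h) hι'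
  have h2 : lam fE = lambdaInvariant p D.X := lam_generator_eq_lambdaInvariant D.X hXt hfE0 hchar'
  have h3 : k ≤ lambdaInvariant p D.X := hk κ γ hκ hγ D hXt
  have h4 : lam fE ≤ lam (fE * h) := lam_le_lam_mul hfE0 hh0
  have h5 : lam fE ∈ A := hA Dm.f hf ϖ hϖeq fE h hι'
  exact ⟨lam fE, h5, by omega, by omega⟩

end Leaf

end Summit.BirchSwinnertonDyer.Rank1Residual.X1.FactorSqueeze

end
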